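import Mathlib
import Literature.Analysis.FluidPDE.GigaMiura2011ScaledAlignmentBlowupLimitHolds
import Literature.Analysis.FluidPDE.KNSSTypeIIHolds
import HarnessLib
/-!
# The Z1 ↔ Z5 exponent dictionary and the sub-Leray KILL FORM (zone Z1 TEMPLATE §T1.22 (K23) made kernel; part XIII)

HONEST FRAMING (cell ns-blowup GROUP B «PROFILE SEARCH», zone Z1 «Type-II log-modulated DSS ansatz for axisymmetric
Navier–Stokes — the template IS the deliverable» and zone Z5 «Hou-2022 collapse at constant ν»; D-0035/D-0074). Z5 reads a
(D)-class collapse through Hou's one-scale exponent `ĉ_l` (length `∝ (T−t)^{ĉ_l}`, `‖u₁‖_∞ ∝ (T−t)⁻¹`, hence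
`‖u‖_∞ ∝ (T−t)^{ĉ_l − 1}`, Z5 SHEET §1.2); Z1 reads the same object through the modulation `a = −λλ̇` of the gauge
`λ = 1/‖u‖_∞` (TEMPLATE (N1)–(N4)). This file makes TEMPLATE §T1.22 (K23) a set of decls:

1. CALCULUS (any `K > 0`, `ĉ`, `t < T`): for the power-law rate `U(t) = K (T−t)^{ĉ−1}` the N-a scale is
   `λ = K⁻¹(T−t)^{1−ĉ}` and the modulation is `a(t) = −λ(t)λ̇(t) = (1 − ĉ) K⁻² (T−t)^{1−2ĉ}`
   (`hasDerivAt_scale_of_houRate`, `modulation_of_houRate`); `ĉ = ½` ⇒ `a ≡ K⁻²/2` (Type I / Leray,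
   `modulation_of_houRate_half`); the Type-I quantity is `√(T−t)·U(t) = K (T−t)^{ĉ−½}` (`typeI_quantity_of_houRate`),
   which tends to `0` as `t ↑ T` iff-side `ĉ > ½` (`tendsto_typeI_quantity_of_houRate_gt_half`) — Z5's band (K+).
2. KILL FORM (composition of two DISCHARGED tree theorems — Leray 1934 §19 (3.9) in the maximality-free form
   `Literature.Analysis.FluidPDE.exists_lerayRate_point_of_unbounded`, and Robinson–Rodrigo–Sadowski Thm 8.17
   `hasSmoothExtensionPast_of_bounded_holds`): a classical Leray–Hopf solution on `[0, T)`, bounded on every closed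
   sub-strip, whose sup-norm obeys a SUB-LERAY ENVELOPE `‖u(t, x)‖ ≤ K (T−t)^{ĉ−1}` with `ĉ > ½` on `[0, T) × ℝ³`, is
   BOUNDED on `[0, T) × ℝ³` (`bounded_of_subLerayEnvelope`) and therefore EXTENDS SMOOTHLY PAST `T`
   (`hasSmoothExtensionPast_of_subLerayEnvelope`): «(K+) sustained to T is not a blow-up at T» — no symmetry hypothesis.

**Nothing here asserts that any Navier–Stokes solution follows such a law**: item 1 is calculus of a given function, item 2 a
necessary-condition (kill) form. A (D) run never certifies a pointwise envelope up to `T`; the decls name what the (K+)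
band MEANS. «violates: n/a — dictionary / kill form»; bears_on LADDER-NS N5/Z1 ↔ N5/Z5 → N1 linear core / N0⁻.
Author: ns-blowup-profile-eng-1 g6, 2026-08-27.
-/

open Real Filter Topology Set
open Literature.Analysis.FluidPDE

namespace Summit.NavierStokesRegularity.OSWSelfSimilar
namespace TypeIIModulationDictionary

/-! ### 1. Calculus of the power-law rate `U(t) = K (T − t)^{ĉ − 1}` in gauge N-a -/

section Calculus

variable {K c T t : ℝ}

/-- **The N-a scale of Hou's rate.** For `U(t) = K (T−t)^{ĉ−1}`, `t < T`: `1/U(t) = K⁻¹ (T−t)^{1−ĉ}` (any `K`; Lean's `0⁻¹ = 0`).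
[new here — dictionary] -/
theorem scale_of_houRate (ht : t < T) :
    (K * (T - t) ^ (c - 1))⁻¹ = K⁻¹ * (T - t) ^ (1 - c) := by
  have hs : 0 < T - t := sub_pos.2 ht
  rw [mul_inv, ← Real.rpow_neg hs.le, show -(c - 1) = 1 - c by ring]

/-- **Derivative of the N-a scale** `λ(t) = K⁻¹ (T−t)^{1−ĉ}`: `λ̇(t) = −(1−ĉ) K⁻¹ (T−t)^{−ĉ}` for `t < T`.
[new here — dictionary] -/
theorem hasDerivAt_scale_of_houRate (ht : t < T) :
    HasDerivAt (fun s => K⁻¹ * (T - s) ^ (1 - c)) (-(1 - c) * K⁻¹ * (T - t) ^ (-c)) t := by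
  have hs : 0 < T - t := sub_pos.2 ht
  have h1 : HasDerivAt (fun s => T - s) (-1) t := (hasDerivAt_id t).const_sub T
  have h2 : HasDerivAt (fun s => (T - s) ^ (1 - c)) ((-1) * (1 - c) * (T - t) ^ (1 - c - 1)) t :=
    h1.rpow_const (Or.inl hs.ne')
  refine (h2.const_mul K⁻¹).congr_deriv ?_
  rw [show (1 : ℝ) - c - 1 = -c by ring]; ring

/-- **TEMPLATE §T1.22 (K23): the modulation of Hou's rate.** With `λ(t) = K⁻¹(T−t)^{1−ĉ}`,
`a(t) := −λ(t) λ̇(t) = (1 − ĉ) K⁻² (T−t)^{1−2ĉ}` for `t < T`. [new here — dictionary] -/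
theorem modulation_of_houRate (ht : t < T) :
    -(K⁻¹ * (T - t) ^ (1 - c)) * (-(1 - c) * K⁻¹ * (T - t) ^ (-c)) = (1 - c) * K⁻¹ ^ 2 * (T - t) ^ (1 - 2 * c) := by
  have hs : 0 < T - t := sub_pos.2 ht
  have h : (T - t) ^ (1 - c) * (T - t) ^ (-c) = (T - t) ^ (1 - 2 * c) := by
    rw [← Real.rpow_add hs]; ring_nf
  calc -(K⁻¹ * (T - t) ^ (1 - c)) * (-(1 - c) * K⁻¹ * (T - t) ^ (-c))
        = (1 - c) * K⁻¹ ^ 2 * ((T - t) ^ (1 - c) * (T - t) ^ (-c)) := by ring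
    _ = (1 - c) * K⁻¹ ^ 2 * (T - t) ^ (1 - 2 * c) := by rw [h]

/-- **`ĉ = ½` is Leray's self-similar rate: the modulation is the CONSTANT `K⁻²/2`** (TEMPLATE (E3)/(N3), Type I).
[new here — dictionary] -/
theorem modulation_of_houRate_half (ht : t < T) :
    (1 - (1 / 2 : ℝ)) * K⁻¹ ^ 2 * (T - t) ^ (1 - 2 * (1 / 2 : ℝ)) = K⁻¹ ^ 2 / 2 := by
  have hs : 0 < T - t := sub_pos.2 ht
  norm_num [Real.rpow_zero]
  ring

/-- **The Type-I quantity of Hou's rate**: `√(T−t) · K (T−t)^{ĉ−1} = K (T−t)^{ĉ − ½}` for `t < T` (Z5 SHEET §1.2: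
«‖u‖_∞ ∝ (T−t)^{ĉ_l − 1} ⇒ Type-I rate ⇔ ĉ_l = ½»). [new here — dictionary] -/
theorem typeI_quantity_of_houRate (ht : t < T) :
    Real.sqrt (T - t) * (K * (T - t) ^ (c - 1)) = K * (T - t) ^ (c - 1 / 2) := by
  have hs : 0 < T - t := sub_pos.2 ht
  rw [Real.sqrt_eq_rpow, show c - 1 / 2 = 1 / 2 + (c - 1) by ring, Real.rpow_add hs]; ring

/-- **(K+) is sub-Leray**: for `ĉ > ½` the Type-I quantity `K s^{ĉ−½}` of Hou's rate tends to `0` as `s = T − t ↓ 0`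
(Z5 SHEET §1.2 «ĉ_l > ½ ⇒ √(T−t)‖u‖_∞ → 0 (slower than Leray's necessary rate)»; TEMPLATE §T1.22 (K23) «ĉ_l > ½ ⇔ a ↑»).
[new here — dictionary] -/
theorem tendsto_typeI_quantity_of_houRate_gt_half (hc : 1 / 2 < c) :
    Tendsto (fun s : ℝ => K * s ^ (c - 1 / 2)) (𝓝[>] 0) (𝓝 0) := by
  have hp : 0 < c - 1 / 2 := by linarith
  have h0 : Tendsto (fun s : ℝ => s ^ (c - 1 / 2)) (𝓝[>] 0) (𝓝 0) := by
    have hcont : ContinuousAt (fun s : ℝ => s ^ (c - 1 / 2)) 0 :=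
      (Real.continuous_rpow_const hp.le).continuousAt
    have := hcont.tendsto
    rw [Real.zero_rpow hp.ne'] at this
    exact this.mono_left nhdsWithin_le_nhds
  simpa using h0.const_mul K

end Calculus

/-! ### 2. The sub-Leray KILL FORM -/

section KillForm

variable {ν T : ℝ} {u : ℝ → EuclideanSpace ℝ (Fin 3) → EuclideanSpace ℝ (Fin 3)} {p : ℝ → EuclideanSpace ℝ (Fin 3) → ℝ}

/-- **A sub-Leray envelope up to `T` forces boundedness on `[0, T) × ℝ³`.** Let `ν > 0`, `T > 0`, `(u, p)` classical on
`[0, T) × ℝ³`, Leray–Hopf from `u 0`, bounded on every closed sub-strip `[0, T₁] × ℝ³` (`T₁ < T`), and suppose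
`‖u(t, x)‖ ≤ K (T−t)^{ĉ−1}` on `[0, T) × ℝ³` with `ĉ > ½`. Then `u` is bounded on `[0, T) × ℝ³`. PROOF: otherwise
Leray's lower bound (`exists_lerayRate_point_of_unbounded`: some `x` with `‖u(t,x)‖ ≥ c√ν/√(T−t)` at EVERY
`t < T`) contradicts the envelope at times with `K (T−t)^{ĉ−½} < c√ν`, which exist because `ĉ − ½ > 0`.
[new here — kill form; cites Leray1934 §19 (3.9) via the tree theorem] -/
theorem bounded_of_subLerayEnvelope (hν : 0 < ν) (hT : 0 < T) (hcl : IsClassicalNSSolutionOn (Ico 0 T) ν 0 u p)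
    (hLH : IsLerayHopfOn T ν 0 (u 0) u) (hbdd : ∀ T₁ ∈ Ioo 0 T, ∃ M : ℝ, ∀ t ∈ Icc 0 T₁, ∀ x, ‖u t x‖ ≤ M)
    {K c : ℝ} (hc : 1 / 2 < c) (henv : ∀ t ∈ Ico 0 T, ∀ x, ‖u t x‖ ≤ K * (T - t) ^ (c - 1)) :
    ∃ M : ℝ, ∀ t ∈ Ico 0 T, ∀ x, ‖u t x‖ ≤ M := by
  by_contra hunb
  obtain ⟨c₀, hc₀, hrate⟩ := exists_lerayRate_point_of_unbounded
  have hL := hrate hν hT hcl hLH hbdd hunb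
  -- pick s = T - t > 0 small with K s^{c - 1/2} < c₀ √ν and s < T
  have h1 : ∀ᶠ s in 𝓝[>] (0 : ℝ), K * s ^ (c - 1 / 2) < c₀ * Real.sqrt ν :=
    (tendsto_typeI_quantity_of_houRate_gt_half (K := K) hc).eventually (eventually_lt_nhds (by positivity))
  have h2 : ∀ᶠ s in 𝓝[>] (0 : ℝ), s < T := by
    have : ∀ᶠ s in 𝓝 (0 : ℝ), s < T := eventually_lt_nhds hT
    exact this.filter_mono nhdsWithin_le_nhds
  have h3 : ∀ᶠ s in 𝓝[>] (0 : ℝ), 0 < s := eventually_mem_nhdsWithin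
  obtain ⟨s, ⟨hs1, hs2⟩, hs3⟩ := ((h1.and h2).and h3).exists
  have ht : T - s ∈ Ico 0 T := ⟨by linarith, by linarith⟩
  obtain ⟨x, hx⟩ := hL (T - s) ht
  have hTs : T - (T - s) = s := by ring
  have hle := henv (T - s) ht x
  rw [hTs] at hx hle
  -- c₀ √ν / √s ≤ ‖u‖ ≤ K s^{c-1}; multiply by √s: c₀ √ν ≤ K s^{c - 1/2}
  have hsq : 0 < Real.sqrt s := Real.sqrt_pos.2 hs3
  have hmul : c₀ * Real.sqrt ν ≤ Real.sqrt s * (K * s ^ (c - 1)) := by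
    have := mul_le_mul_of_nonneg_left (hx.trans hle) hsq.le
    rwa [mul_div_cancel₀ _ hsq.ne'] at this
  have hmul' : c₀ * Real.sqrt ν ≤ K * s ^ (c - 1 / 2) := by
    have h := typeI_quantity_of_houRate (K := K) (c := c) (T := s) (t := 0) hs3
    simp only [sub_zero] at h
    rwa [h] at hmul
  linarith

/-- **KILL FORM: (K+) sustained to `T` is not a blow-up at `T`.** Under the hypotheses of `bounded_of_subLerayEnvelope`
the solution extends as a classical solution past `T` (`HasSmoothExtensionPast ν 0 u T`), by Robinson–Rodrigo–Sadowski
Thm 8.17 (`hasSmoothExtensionPast_of_bounded_holds`). No symmetry is assumed. This is the decl behind TEMPLATE §T1.22 (K23)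
«ĉ_l > ½ ⇔ a ↑ — not a singularity shape» and Z5 SHEET §1.2's (K+) sentence. [new here — kill form; cites RobinsonRodrigoSadowski2016 Thm 8.17 via the tree theorem] -/
theorem hasSmoothExtensionPast_of_subLerayEnvelope (hν : 0 < ν) (hT : 0 < T)
    (hcl : IsClassicalNSSolutionOn (Ico 0 T) ν 0 u p) (hLH : IsLerayHopfOn T ν 0 (u 0) u)
    (hbdd : ∀ T₁ ∈ Ioo 0 T, ∃ M : ℝ, ∀ t ∈ Icc 0 T₁, ∀ x, ‖u t x‖ ≤ M)
    {K c : ℝ} (hc : 1 / 2 < c) (henv : ∀ t ∈ Ico 0 T, ∀ x, ‖u t x‖ ≤ K * (T - t) ^ (c - 1)) :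
    HasSmoothExtensionPast ν 0 u T :=
  hasSmoothExtensionPast_of_bounded_holds hν hT hcl hLH (bounded_of_subLerayEnvelope hν hT hcl hLH hbdd hc henv)

/-- **Contrapositive (the census shape): at a genuine blow-up time no sub-Leray envelope holds.** If `(u, p)` is as in
`bounded_of_subLerayEnvelope` but does NOT extend smoothly past `T`, then for every `K` and every `ĉ > ½` the envelope
`‖u(t,x)‖ ≤ K (T−t)^{ĉ−1}` FAILS somewhere on `[0, T) × ℝ³` — a Z5 (K+) reading «up to T» is incompatible with blow-up at
`T`. [new here — kill form] -/
theorem exists_gt_houRate_of_not_hasSmoothExtensionPast (hν : 0 < ν) (hT : 0 < T)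
    (hcl : IsClassicalNSSolutionOn (Ico 0 T) ν 0 u p) (hLH : IsLerayHopfOn T ν 0 (u 0) u)
    (hbdd : ∀ T₁ ∈ Ioo 0 T, ∃ M : ℝ, ∀ t ∈ Icc 0 T₁, ∀ x, ‖u t x‖ ≤ M)
    (hsing : ¬ HasSmoothExtensionPast ν 0 u T) (K : ℝ) {c : ℝ} (hc : 1 / 2 < c) :
    ∃ t ∈ Ico 0 T, ∃ x, K * (T - t) ^ (c - 1) < ‖u t x‖ := by
  by_contra h
  push Not at h
  exact hsing (hasSmoothExtensionPast_of_subLerayEnvelope hν hT hcl hLH hbdd hc h)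

end KillForm

end TypeIIModulationDictionary
end Summit.NavierStokesRegularity.OSWSelfSimilar
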